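import Summits.CriticalPhenomena.PercolationContinuityZ3.Theorems.Transplant.FKConnectivityAllQAntipodalRootFormGenTransfer
import Summits.CriticalPhenomena.PercolationContinuityZ3.Theorems.Transplant.FKConnectivityAllQAntipodalRootFormAttachP

/-!
# Connectivity correlation inequalities for `φ_{w,q}`, every `q > 0` — ROOT-FORM CALCULUS FOR ANY NUMBER OF SPECIALS, file 61δ:
# general PARALLEL attachment of a special-free box, `A ∥ 𝓔`, for pattern-indexed environments (port of file 61u to `Gen.EDat ι`)

Support file (`--supports stmt-CriticalPhenomena-4575`), FK sub-lane `prim-bschramm-fk-2` (gen 29); builds on p205010 (kernel theorem,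
internal audit signed; external expert review pending).  Definition `Gen.attP`; the box-side objects `acomb`, `kd`, `aggW` and their lemmas are
those of file 61u.  No named facts, no sorries; standard axioms.  `Gen.gattP_Mt_nonneg`: fact 1 for `A ∥ 𝓔` from facts 1, 2, 4 of `𝓔` and
Theorem U at exact level for `A`, for environments with any number of specials. [folklore]
-/

noncomputable section

namespace Summit.CriticalPhenomena.PercolationContinuityZ3.Theorems

namespace FK

namespace RootForm

namespace Gen

open Finset Base

variable {ι : Type*} [Fintype ι] [DecidableEq ι]

/-- **The environment `A ∥ 𝓔`** of an abstract special-free box `A` (configuration `α ↦` level and pole bits) attached in parallel to a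
two-special environment `𝓔`: pattern data = `acomb` of the box datum with the pattern datum. (memo FROM-fk-2-g28-ROOT-FORM §3) -/
def attP {BA C : Type*} (A : BA → SDat) (E : Env ι C) : Env ι (BA × C) := fun p => ⟨fun P => acomb (A p.1) ((E p.2).d P)⟩

section Pointwise

variable (a : SDat) (e : EDat ι) (J : ℤ)

/-- **The slot integrands of `A ∥ 𝓔` by kind.** [folklore] -/
theorem gslots_attP_kind {BA C : Type*} (A : BA → SDat) (E : Env ι C) (α : BA) (γ : C) :
    ((A α).c = false → (A α).cb = false →
      (attP A E (α, γ)).gslot1 J = (E γ).gslot1 (J - (A α).L) ∧ (attP A E (α, γ)).gslot0 J = (E γ).gslot0 (J - (A α).L)) ∧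
    ((A α).c = true → (A α).cb = false →
      (attP A E (α, γ)).gslot1 J = (parE E (true, γ)).gslot1 (J - (A α).L) ∧ (attP A E (α, γ)).gslot0 J = (parE E (true, γ)).gslot0 (J - (A α).L)) ∧
    ((A α).c = false → (A α).cb = true →
      (attP A E (α, γ)).gslot1 J = (parE E (false, γ)).gslot1 (J - (A α).L) ∧ (attP A E (α, γ)).gslot0 J = (parE E (false, γ)).gslot0 (J - (A α).L)) ∧
    ((A α).c = true → (A α).cb = true →
      (attP A E (α, γ)).gslot1 J = (E γ).gandCon (J - (A α).L - 1) + (E γ).grconE (J - (A α).L) ∧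
        (attP A E (α, γ)).gslot0 J = (E γ).gandCon (J - (A α).L - 1) - (E γ).grconE (J - (A α).L)) := by
  refine ⟨fun hc hcb => ?_, fun hc hcb => ?_, fun hc hcb => ?_, fun hc hcb => ?_⟩
  · have h := gintegrands_of_addLam (E γ) (attP A E (α, γ)) (A α).L (fun P => comb_of_kind00 _ _ hc hcb) J
    exact ⟨h.1, h.2.1⟩
  · have h := gintegrands_of_addLam (parE E (true, γ)) (attP A E (α, γ)) (A α).L (fun P => comb_of_kind10 _ _ hc hcb) J
    exact ⟨h.1, h.2.1⟩
  · have h := gintegrands_of_addLam (parE E (false, γ)) (attP A E (α, γ)) (A α).L (fun P => comb_of_kind01 _ _ hc hcb) J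
    exact ⟨h.1, h.2.1⟩
  · have h := gintegrands_of_addLam (((E γ).par true).par false) (attP A E (α, γ)) (A α).L (fun P => comb_of_kind11 _ _ hc hcb) J
    rw [h.1, h.2.1, show (false : Bool) = !true from rfl, EDat.gslot1_par_par_mixed, EDat.gslot0_par_par_mixed]
    exact ⟨by ring_nf, by ring_nf⟩

end Pointwise

section Main

variable {BA C : Type*} [Fintype BA] [Preorder BA] [Fintype C] [Preorder C] (A : BA → SDat) (E : Env ι C)

omit [Fintype BA] [Preorder BA] [Fintype C] [Preorder C] in
set_option linter.unusedSimpArgs false in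
/-- **Pointwise decomposition of the integrand of `A ∥ 𝓔` by the kind of the box configuration.** [folklore] -/
theorem gattP_integrand_kind (H0 H1 : BA × C → ℝ) (J : ℤ) (α : BA) (γ : C) :
    H1 (α, γ) * (attP A E (α, γ)).gslot1 J + H0 (α, γ) * (attP A E (α, γ)).gslot0 J =
      kd (A α) false false * (H1 (α, γ) * (E γ).gslot1 (J - (A α).L) + H0 (α, γ) * (E γ).gslot0 (J - (A α).L))
      + kd (A α) true true * ((H1 (α, γ) + H0 (α, γ)) * (E γ).gandCon (J - (A α).L - 1) + (H1 (α, γ) - H0 (α, γ)) * (E γ).grconE (J - (A α).L))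
      + kd (A α) true false * (H1 (α, γ) * (parE E (true, γ)).gslot1 (J - (A α).L) + H0 (α, γ) * (parE E (true, γ)).gslot0 (J - (A α).L))
      + kd (A α) false true * (H1 (α, γ) * (parE E (false, γ)).gslot1 (J - (A α).L) + H0 (α, γ) * (parE E (false, γ)).gslot0 (J - (A α).L)) := by
  obtain ⟨h00, h10, h01, h11⟩ := gslots_attP_kind J A E α γ
  cases hc : (A α).c <;> cases hcb : (A α).cb
  · obtain ⟨e1, e0⟩ := h00 hc hcb
    simp only [kd, hc, hcb, e1, e0, Bool.true_eq_false, Bool.false_eq_true, and_self, and_true, and_false, true_and, false_and,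
      if_true, if_false]; ring
  · obtain ⟨e1, e0⟩ := h01 hc hcb
    simp only [kd, hc, hcb, e1, e0, Bool.true_eq_false, Bool.false_eq_true, and_self, and_true, and_false, true_and, false_and,
      if_true, if_false]; ring
  · obtain ⟨e1, e0⟩ := h10 hc hcb
    simp only [kd, hc, hcb, e1, e0, Bool.true_eq_false, Bool.false_eq_true, and_self, and_true, and_false, true_and, false_and,
      if_true, if_false]; ring
  · obtain ⟨e1, e0⟩ := h11 hc hcb
    simp only [kd, hc, hcb, e1, e0, Bool.true_eq_false, Bool.false_eq_true, and_self, and_true, and_false, true_and, false_and,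
      if_true, if_false]; ring

omit [Preorder BA] [Preorder C] in
/-- The mixed-kind part of the root functional of `A ∥ 𝓔`, regrouped by the level of the box configuration, is a sum of parallel transforms
of `𝓔` against the aggregate weights. [folklore] -/
theorem gattP_mixed_eq (H0 H1 : BA × C → ℝ) (J : ℤ) :
    ∑ α, ∑ γ, kd (A α) true false * (H1 (α, γ) * (parE E (true, γ)).gslot1 (J - (A α).L) + H0 (α, γ) * (parE E (true, γ)).gslot0 (J - (A α).L))
      + ∑ α, ∑ γ, kd (A α) false true *
          (H1 (α, γ) * (parE E (false, γ)).gslot1 (J - (A α).L) + H0 (α, γ) * (parE E (false, γ)).gslot0 (J - (A α).L)) =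
    ∑ K ∈ Finset.univ.image (fun α => (A α).L), gMt (parE E) (aggW A K H0) (aggW A K H1) (J - K) := by
  rw [← Finset.sum_add_distrib]
  simp only [← Finset.sum_add_distrib]
  -- insert the level indicator (the γ-sum of a fixed `α` only involves the level of `α`)
  have ins : ∀ α, (∑ γ, (kd (A α) true false * (H1 (α, γ) * (parE E (true, γ)).gslot1 (J - (A α).L) + H0 (α, γ) * (parE E (true, γ)).gslot0 (J - (A α).L))
      + kd (A α) false true * (H1 (α, γ) * (parE E (false, γ)).gslot1 (J - (A α).L) + H0 (α, γ) * (parE E (false, γ)).gslot0 (J - (A α).L)))) =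
      ∑ K ∈ Finset.univ.image (fun α => (A α).L), if (A α).L = K then
        ∑ γ, (kd (A α) true false * (H1 (α, γ) * (parE E (true, γ)).gslot1 (J - K) + H0 (α, γ) * (parE E (true, γ)).gslot0 (J - K))
          + kd (A α) false true * (H1 (α, γ) * (parE E (false, γ)).gslot1 (J - K) + H0 (α, γ) * (parE E (false, γ)).gslot0 (J - K))) else 0 := by
    intro α
    rw [Finset.sum_ite_eq, if_pos (Finset.mem_image_of_mem _ (Finset.mem_univ α))]
  simp_rw [ins]
  rw [Finset.sum_comm]
  refine Finset.sum_congr rfl fun K _ => ?_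
  unfold gMt
  rw [sum_bool_prod]
  simp only [aggW, if_true, Bool.false_eq_true, if_false, Finset.sum_mul, ← Finset.sum_add_distrib]
  rw [Finset.sum_comm]
  refine Finset.sum_congr rfl fun α _ => ?_
  rw [← boole_mul, Finset.mul_sum]
  refine Finset.sum_congr rfl fun γ _ => by ring

/-- **Fact 1 for `A ∥ 𝓔`.**  From facts 1, 2, 4 of `𝓔` and Theorem U at exact level for the special-free box `A`, the nested root functional of
`A ∥ 𝓔` is nonnegative against every monotone nested nonnegative weight pair. [folklore] -/
theorem gattP_Mt_nonneg
    (hU : ∀ h : BA → ℝ, Monotone h → (∀ α, 0 ≤ h α) → ∀ K : ℤ,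
      0 ≤ ∑ α, h α * ((if (A α).L = K then (1 : ℝ) else 0) * (kd (A α) true false - kd (A α) false true)))
    (f1 : ∀ h0 h1 : C → ℝ, Monotone h0 → Monotone h1 → (∀ γ, 0 ≤ h0 γ) → (∀ γ, h0 γ ≤ h1 γ) → ∀ J : ℤ, 0 ≤ gMt E h0 h1 J)
    (f2 : ∀ h0 h1 : Bool × C → ℝ, Monotone h0 → Monotone h1 → (∀ p, 0 ≤ h0 p) → (∀ p, h0 p ≤ h1 p) → ∀ J : ℤ, 0 ≤ gMt (parE E) h0 h1 J)
    (f4 : ∀ h : C → ℝ, Monotone h → (∀ γ, 0 ≤ h γ) → ∀ J : ℤ, 0 ≤ ∑ γ, h γ * (E γ).gandCon J)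
    {H0 H1 : BA × C → ℝ} (m0 : Monotone H0) (m1 : Monotone H1) (n0 : ∀ p, 0 ≤ H0 p) (le : ∀ p, H0 p ≤ H1 p) (J : ℤ) :
    0 ≤ gMt (attP A E) H0 H1 J := by
  have n1 : ∀ p, 0 ≤ H1 p := fun p => (n0 p).trans (le p)
  unfold gMt
  rw [Fintype.sum_prod_type]
  simp_rw [gattP_integrand_kind A E H0 H1 J]
  simp only [Finset.sum_add_distrib]
  rw [add_assoc, gattP_mixed_eq]
  refine add_nonneg (add_nonneg (Finset.sum_nonneg fun α _ => ?_) (Finset.sum_nonneg fun α _ => ?_)) (Finset.sum_nonneg fun K _ => ?_)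
  · rw [← Finset.mul_sum]
    exact mul_nonneg (kd_nonneg _ _ _) (f1 _ _ (mono_right m0 α) (mono_right m1 α) (fun γ => n0 _) (fun γ => le _) _)
  · rw [← Finset.mul_sum]
    refine mul_nonneg (kd_nonneg _ _ _) ?_
    rw [Finset.sum_add_distrib]
    refine add_nonneg (f4 _ ((mono_right m1 α).add (mono_right m0 α)) (fun γ => add_nonneg (n1 _) (n0 _)) _)
      (Finset.sum_nonneg fun γ _ => mul_nonneg (sub_nonneg.2 (le _)) (EDat.grconE_nonneg _ _))
  · exact f2 _ _ (aggW_mono A hU m0 n0 K) (aggW_mono A hU m1 n1 K) (aggW_nonneg A n0 K) (aggW_le A le K) _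

end Main

end Gen

end RootForm

end FK

end Summit.CriticalPhenomena.PercolationContinuityZ3.Theorems

end
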